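import Literature.Algebra.Homology.DiscreteRepLayerColimit
import Literature.Algebra.Homology.RepExtGroupCohomologyRestriction
import HarnessLib

/-!
# `Extⁿ_{C_Γ}(k, M) = lim→_U Hⁿ(Γ⧸U, M^U)` with the layers in Mathlib's `groupCohomology`:
# the transitions of the colimit theorem ARE the inflation maps `groupCohomology.map`

Topic `Algebra/Homology`; namespaces `Literature.Algebra.Homology.DiscreteRep` and
`Literature.Algebra.Homology.DiscreteRep.LayerColimit`.  Two definitions with bodies (`stepG`, an
abbreviation for Mathlib's inflation map between two layers, and `inflG`, inflation from a finite layer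
in `groupCohomology` currency) and theorems; no named fact, no instance, no `sorry`.  Sequel of
`DiscreteRepLayerColimit` (door-c4 g14, item (d): `exists_infl_eq`, `exists_step_eq_zero`,
`ext_eq_zero_of_forall_exists_step_eq_zero` for the `Ext`-layers `Extⁿ_{Rep k (Γ⧸U)}(k, M^U)`) and of
`RepExtGroupCohomologyRestriction` (door-c4 g15, item (N1): the dictionary
`E : Extⁿ_{Rep k G}(k, A) ≃+ Hⁿ(G, A)` commutes with change of group).

THE POINT.  The cell's finite-layer theorems (class modules, fundamental classes, Tate–Nakayama,
idèle-class vanishing, `(U:V)·Inf` vanishing — door-c4 g11/g12, door-c5, door-c6) are stated in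
Mathlib's `groupCohomology (Rep ℤ Gal(E/F))` with Mathlib's inflation maps `groupCohomology.map`;
the colimit theorem (d) is stated on `Abelian.Ext` with the transitions `extInfStep`.  Here:

* **`extTrivialAddEquivGroupCohomology_extInfStep`**: `E (extInfStep U V y) =
  groupCohomology.map (Γ⧸V → Γ⧸U) (M^U ⊆ M^V) n (E y)` — the transition IS the inflation map;
* `stepG U V h M n := groupCohomology.map (quotMap U V h) (invariantsStepIncl U V h M) n`,
  `inflG U M n := infl U M n ∘ E⁻¹ : Hⁿ(Γ⧸U, M^U) →+ Extⁿ_{C_Γ}(k, M)`, `inflG_stepG`, `stepG_stepG`;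
* **(d) in `groupCohomology` currency** (`Γ` profinite): `exists_inflG_eq` (every class of
  `Extⁿ_{C_Γ}(k, M)` is inflated from some `Hⁿ(Γ⧸U, M^U)`), `exists_stepG_eq_zero` (a class dying in
  the limit dies under some inflation map `Hⁿ(Γ⧸U, M^U) → Hⁿ(Γ⧸V, M^V)`), `inflG_injective_zero/one`,
  `exists_stepG_eq_stepG`, **`ext_eq_zero_of_forall_exists_stepG_eq_zero`** (vanishing transfer:
  if every class of every `Hⁿ(Γ⧸U, M^U)` is killed by some inflation map, `Extⁿ_{C_Γ}(k, M) = 0` —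
  the shape of Milne ADT I Lemma 1.9 (b) / Harari Lemma 16.20 used for `H²(Γ_K, C̄)`-type arguments).

Written for Route A of the Poitou–Tate programme of crux `stmt-BirchSwinnertonDyer-19295` (cell
`bsd-schneider-ideate`, seat door-c4 gen 15).  HONEST FRAMING: homological algebra only; no
arithmetic statement and no case of BSD is proved here.

## References
* J.-P. Serre, *Galois Cohomology*, Springer (1997), I §2.2 Proposition 8
  (`H^q(G, A) = lim→ H^q(G/U, A^U)`). [SerreGaloisCohomology1997]
* D. Harari, *Galois Cohomology and Class Field Theory*, Universitext (2020), §4.3 Proposition 4.18,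
  Remark 4.24; §16.3 Lemma 16.20. [Harari2020]
* K. S. Brown, *Cohomology of Groups*, GTM 87 (1982), III §8 (functoriality). [Brown1982CohomologyGroups]
-/

noncomputable section

universe u

namespace Literature.Algebra.Homology

namespace DiscreteRep

open CategoryTheory CategoryTheory.Limits CategoryTheory.Abelian

variable {k Γ : Type u} [CommRing k] [Group Γ] [TopologicalSpace Γ] [IsTopologicalGroup Γ]

/-! ## §1 The transition `extInfStep` is Mathlib's inflation map -/

section Subgroups

variable (U V : Subgroup Γ) [U.Normal] [V.Normal] (hVU : V ≤ U) (M : DiscreteRepCat k Γ)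

omit [IsTopologicalGroup Γ] in
/-- **`E (extInfStep U V y) = groupCohomology.map (Γ⧸V → Γ⧸U) (M^U ⊆ M^V) (E y)`**: under the
dictionary `E = RepExt.extTrivialAddEquivGroupCohomology`, the transition map of the direct system
`U ↦ Extⁿ_{Rep k (Γ⧸U)}(k, M^U)` is Mathlib's inflation map on inhomogeneous cochains.
[cite: SerreGaloisCohomology1997, I §2.2 Proposition 8][cite: Brown1982CohomologyGroups, III §8] -/
theorem extTrivialAddEquivGroupCohomology_extInfStep (n : ℕ)
    (y : Ext (Rep.trivial k (Γ ⧸ U) k) ((invariantsQuotFunctor k U).obj M) n) :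
    RepExt.extTrivialAddEquivGroupCohomology ((invariantsQuotFunctor k V).obj M) n
        (extInfStep U V hVU M n y) =
      groupCohomology.map (quotMap U V hVU) (invariantsStepIncl U V hVU M) n
        (RepExt.extTrivialAddEquivGroupCohomology ((invariantsQuotFunctor k U).obj M) n y) := by
  rw [extInfStep_apply]
  exact RepExt.extTrivialAddEquivGroupCohomology_mapExactFunctor_comp (quotMap U V hVU)
    (invariantsStepIncl U V hVU M) y

omit [IsTopologicalGroup Γ] in
/-- Inverse form: `E⁻¹ (groupCohomology.map … c) = extInfStep U V (E⁻¹ c)`.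
[cite: SerreGaloisCohomology1997, I §2.2 Proposition 8] -/
theorem extTrivialAddEquivGroupCohomology_symm_map_invariantsStepIncl (n : ℕ)
    (c : groupCohomology ((invariantsQuotFunctor k U).obj M) n) :
    (RepExt.extTrivialAddEquivGroupCohomology ((invariantsQuotFunctor k V).obj M) n).symm
        (groupCohomology.map (quotMap U V hVU) (invariantsStepIncl U V hVU M) n c) =
      extInfStep U V hVU M n
        ((RepExt.extTrivialAddEquivGroupCohomology ((invariantsQuotFunctor k U).obj M) n).symm c) := by
  apply (RepExt.extTrivialAddEquivGroupCohomology ((invariantsQuotFunctor k V).obj M) n).injective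
  rw [AddEquiv.apply_symm_apply, extTrivialAddEquivGroupCohomology_extInfStep, AddEquiv.apply_symm_apply]

end Subgroups

namespace LayerColimit

/-! ## §2 The direct system `U ↦ Hⁿ(Γ⧸U, M^U)` over the open normal subgroups -/

section System

variable (U V : OpenNormalSubgroup Γ) (h : (V : Subgroup Γ) ≤ U) (M : DiscreteRepCat k Γ) (n : ℕ)

/-- **The transition `Hⁿ(Γ⧸U, M^U) ⟶ Hⁿ(Γ⧸V, M^V)`** for `V ≤ U`: Mathlib's inflation map
`groupCohomology.map (Γ⧸V → Γ⧸U) (M^U ⊆ M^V) n`. [cite: SerreGaloisCohomology1997, I §2.2 Proposition 8] -/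
abbrev stepG :
    groupCohomology ((invariantsQuotFunctor k (U : Subgroup Γ)).obj M) n ⟶
      groupCohomology ((invariantsQuotFunctor k (V : Subgroup Γ)).obj M) n :=
  groupCohomology.map (quotMap (U : Subgroup Γ) (V : Subgroup Γ) h)
    (invariantsStepIncl (U : Subgroup Γ) (V : Subgroup Γ) h M) n

/-- The dictionary at the layer `U`: `E_U : Extⁿ_{Rep k (Γ⧸U)}(k, M^U) ≃+ Hⁿ(Γ⧸U, M^U)`.
[cite: Brown1982CohomologyGroups, III §1] -/
abbrev layerE :
    LExt U M n ≃+ groupCohomology ((invariantsQuotFunctor k (U : Subgroup Γ)).obj M) n :=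
  RepExt.extTrivialAddEquivGroupCohomology ((invariantsQuotFunctor k (U : Subgroup Γ)).obj M) n

/-- **Inflation from the finite layer `U` in `groupCohomology` currency**:
`inflG U M n : Hⁿ(Γ⧸U, M^U) →+ Extⁿ_{C_Γ}(k, M)`, `c ↦ infl U M n (E_U⁻¹ c)`.
[cite: SerreGaloisCohomology1997, I §2.2 Proposition 8] -/
def inflG : groupCohomology ((invariantsQuotFunctor k (U : Subgroup Γ)).obj M) n →+ Ext (triv (Γ := Γ) k) M n :=
  (infl U M n).comp (layerE U M n).symm.toAddMonoidHom

/-- Formula. [cite: SerreGaloisCohomology1997, I §2.2 Proposition 8] -/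
theorem inflG_apply (c : groupCohomology ((invariantsQuotFunctor k (U : Subgroup Γ)).obj M) n) :
    inflG U M n c = infl U M n ((layerE U M n).symm c) := rfl

/-- `inflG U (E_U y) = infl U y`. [cite: SerreGaloisCohomology1997, I §2.2 Proposition 8] -/
theorem inflG_layerE (y : LExt U M n) : inflG U M n (layerE U M n y) = infl U M n y := by
  rw [inflG_apply, AddEquiv.symm_apply_apply]

omit [IsTopologicalGroup Γ] in
/-- **`E_V (step U V y) = stepG U V (E_U y)`.** [cite: SerreGaloisCohomology1997, I §2.2 Proposition 8] -/
theorem layerE_step (y : LExt U M n) :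
    layerE V M n (step U V h M n y) = stepG U V h M n (layerE U M n y) :=
  extTrivialAddEquivGroupCohomology_extInfStep (U : Subgroup Γ) (V : Subgroup Γ) h M n y

omit [IsTopologicalGroup Γ] in
/-- **`E_V⁻¹ (stepG U V c) = step U V (E_U⁻¹ c)`.** [cite: SerreGaloisCohomology1997, I §2.2 Proposition 8] -/
theorem layerE_symm_stepG (c : groupCohomology ((invariantsQuotFunctor k (U : Subgroup Γ)).obj M) n) :
    (layerE V M n).symm (stepG U V h M n c) = step U V h M n ((layerE U M n).symm c) :=
  extTrivialAddEquivGroupCohomology_symm_map_invariantsStepIncl (U : Subgroup Γ) (V : Subgroup Γ) h M n c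

/-- **Compatibility of the inflations with the transitions**: `inflG V (stepG U V c) = inflG U c`.
[cite: SerreGaloisCohomology1997, I §2.2 Proposition 8] -/
theorem inflG_stepG (c : groupCohomology ((invariantsQuotFunctor k (U : Subgroup Γ)).obj M) n) :
    inflG V M n (stepG U V h M n c) = inflG U M n c := by
  rw [inflG_apply, inflG_apply, layerE_symm_stepG]
  exact extInf_extInfStep (U : Subgroup Γ) (V : Subgroup Γ) (coe_isOpen U) (coe_isOpen V) h M n _

omit [IsTopologicalGroup Γ] in
/-- **Transitivity of the transitions**: `stepG V W (stepG U V c) = stepG U W c`.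
[cite: SerreGaloisCohomology1997, I §2.2 Proposition 8] -/
theorem stepG_stepG (W : OpenNormalSubgroup Γ) (h' : (W : Subgroup Γ) ≤ V)
    (c : groupCohomology ((invariantsQuotFunctor k (U : Subgroup Γ)).obj M) n) :
    stepG V W h' M n (stepG U V h M n c) = stepG U W (h'.trans h) M n c := by
  apply (layerE W M n).symm.injective
  rw [layerE_symm_stepG, layerE_symm_stepG, layerE_symm_stepG]
  exact extInfStep_extInfStep M (U : Subgroup Γ) (V : Subgroup Γ) (W : Subgroup Γ) h h' n _

end System

/-! ## §3 The colimit theorem (d) with layers `Hⁿ(Γ⧸U, M^U)` (`Γ` profinite) -/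

section Colimit

variable [CompactSpace Γ] [TotallyDisconnectedSpace Γ]

/-- **SURJECTIVITY: every class of `Extⁿ_{C_Γ}(k, M)` is inflated from some `Hⁿ(Γ⧸U, M^U)`.**
[cite: SerreGaloisCohomology1997, I §2.2 Proposition 8][cite: Harari2020, §4.3 Proposition 4.18, Remark 4.24] -/
theorem exists_inflG_eq (n : ℕ) (M : DiscreteRepCat k Γ) (x : Ext (triv (Γ := Γ) k) M n) :
    ∃ (U : OpenNormalSubgroup Γ) (c : groupCohomology ((invariantsQuotFunctor k (U : Subgroup Γ)).obj M) n),
      inflG U M n c = x := by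
  obtain ⟨U, y, rfl⟩ := exists_infl_eq n M x
  exact ⟨U, layerE U M n y, inflG_layerE U M n y⟩

/-- **INJECTIVITY: a class of `Hⁿ(Γ⧸U, M^U)` that dies in `Extⁿ_{C_Γ}(k, M)` is killed by some
inflation map `Hⁿ(Γ⧸U, M^U) → Hⁿ(Γ⧸V, M^V)`, `V ≤ U` open normal.**
[cite: SerreGaloisCohomology1997, I §2.2 Proposition 8][cite: Harari2020, §4.3 Proposition 4.18, Remark 4.24] -/
theorem exists_stepG_eq_zero (n : ℕ) (M : DiscreteRepCat k Γ) (U : OpenNormalSubgroup Γ)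
    (c : groupCohomology ((invariantsQuotFunctor k (U : Subgroup Γ)).obj M) n) (hc : inflG U M n c = 0) :
    ∃ (V : OpenNormalSubgroup Γ) (h : (V : Subgroup Γ) ≤ U), stepG U V h M n c = 0 := by
  obtain ⟨V, h, hV⟩ := exists_step_eq_zero n M U ((layerE U M n).symm c) hc
  refine ⟨V, h, (layerE V M n).symm.injective ?_⟩
  rw [layerE_symm_stepG, hV, map_zero]

omit [CompactSpace Γ] [TotallyDisconnectedSpace Γ] in
/-- In degree `0` the inflation `H⁰(Γ⧸U, M^U) → Ext⁰_{C_Γ}(k, M)` is injective.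
[cite: SerreGaloisCohomology1997, I §2.2 Proposition 8] -/
theorem inflG_injective_zero (M : DiscreteRepCat k Γ) (U : OpenNormalSubgroup Γ) :
    Function.Injective (inflG U M 0) :=
  (extInf_zero_injective (U : Subgroup Γ) (coe_isOpen U) M).comp (layerE U M 0).symm.injective

omit [CompactSpace Γ] [TotallyDisconnectedSpace Γ] in
/-- In degree `1` the inflation `H¹(Γ⧸U, M^U) → Ext¹_{C_Γ}(k, M)` is injective (inflation–restriction).
[cite: SerreGaloisCohomology1997, I §2.2 Proposition 8] -/
theorem inflG_injective_one (M : DiscreteRepCat k Γ) (U : OpenNormalSubgroup Γ) :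
    Function.Injective (inflG U M 1) :=
  (injective_infl_one M U).comp (layerE U M 1).symm.injective

/-- **Two classes with the same image in the limit agree after some inflation map.**
[cite: SerreGaloisCohomology1997, I §2.2 Proposition 8] -/
theorem exists_stepG_eq_stepG (n : ℕ) (M : DiscreteRepCat k Γ) (U : OpenNormalSubgroup Γ)
    (c c' : groupCohomology ((invariantsQuotFunctor k (U : Subgroup Γ)).obj M) n)
    (h : inflG U M n c = inflG U M n c') :
    ∃ (V : OpenNormalSubgroup Γ) (hVU : (V : Subgroup Γ) ≤ U), stepG U V hVU M n c = stepG U V hVU M n c' := by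
  obtain ⟨V, hVU, hV⟩ := exists_stepG_eq_zero n M U (c - c') (by rw [map_sub, h, sub_self])
  exact ⟨V, hVU, sub_eq_zero.1 (by rw [← map_sub, hV])⟩

/-- **VANISHING TRANSFER in `groupCohomology` currency (the shape of Milne ADT I Lemma 1.9 (b) /
Harari Lemma 16.20): if every class of every `Hⁿ(Γ⧸U, M^U)` is killed by some inflation map
`Hⁿ(Γ⧸U, M^U) → Hⁿ(Γ⧸V, M^V)`, then `Extⁿ_{C_Γ}(k, M) = 0`.**
[cite: SerreGaloisCohomology1997, I §2.2 Proposition 8][cite: Harari2020, §16.3 Lemma 16.20] -/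
theorem ext_eq_zero_of_forall_exists_stepG_eq_zero (n : ℕ) (M : DiscreteRepCat k Γ)
    (h : ∀ (U : OpenNormalSubgroup Γ) (c : groupCohomology ((invariantsQuotFunctor k (U : Subgroup Γ)).obj M) n),
      ∃ (V : OpenNormalSubgroup Γ) (hVU : (V : Subgroup Γ) ≤ U), stepG U V hVU M n c = 0)
    (x : Ext (triv (Γ := Γ) k) M n) : x = 0 := by
  refine ext_eq_zero_of_forall_exists_step_eq_zero n M (fun U y => ?_) x
  obtain ⟨V, hVU, hV⟩ := h U (layerE U M n y)
  refine ⟨V, hVU, (layerE V M n).injective ?_⟩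
  rw [layerE_step, hV, map_zero]

/-- **The limit group vanishes iff every layer class dies deeper** (converse direction included:
if `Extⁿ_{C_Γ}(k, M) = 0` then every class of `Hⁿ(Γ⧸U, M^U)` is killed by some inflation map).
[cite: SerreGaloisCohomology1997, I §2.2 Proposition 8] -/
theorem forall_ext_eq_zero_iff (n : ℕ) (M : DiscreteRepCat k Γ) :
    (∀ x : Ext (triv (Γ := Γ) k) M n, x = 0) ↔
      ∀ (U : OpenNormalSubgroup Γ) (c : groupCohomology ((invariantsQuotFunctor k (U : Subgroup Γ)).obj M) n),
        ∃ (V : OpenNormalSubgroup Γ) (hVU : (V : Subgroup Γ) ≤ U), stepG U V hVU M n c = 0 := by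
  constructor
  · intro hx U c
    exact exists_stepG_eq_zero n M U c (hx _)
  · intro h x
    exact ext_eq_zero_of_forall_exists_stepG_eq_zero n M h x

end Colimit

end LayerColimit

end DiscreteRep

end Literature.Algebra.Homology
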